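import Literature.Computability.Complexity.RootClock
import Literature.Computability.Complexity.GuardedBallStages
import Literature.Computability.Complexity.NondeterministicKannanSearch
import Literature.Computability.Complexity.TruncMapMachine
import Literature.Computability.Complexity.TimeBoundsComplProofs
import Literature.Computability.Complexity.MurrayWilliams2018
import Literature.Computability.Complexity.CountingHierarchyProofs
import HarnessLib

/-!
# `NSUBEXP` is closed under a polynomial guess followed by polynomially many guarded queries

Trunk `CplxCore`. Third of three files (`RootClock`, `GuardedBallStages`, this one). Main result:

* **`mem_NSUBEXP_of_guardedBall`**: for `A ∈ NSUBEXP`, `R, S ∈ P`, `f ∈ FP` and a polynomial `p`,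
  the language
  `guardedBall A R S f p = {x | ∃ Y, |Y| ≤ p(|x|) ∧ ⟨x, Y⟩ ∈ R ∧ ∀ j < |⟨x, Y⟩|, ⟨⟨x, Y⟩, 1ʲ⟩ ∈ S → f ⟨⟨x, Y⟩, 1ʲ⟩ ∈ A}`
  is in `NSUBEXP = ⋂_{r>0} NTIME(2^{⌊n^{1/r}⌋})` (`NSubexp.lean`).

This is the verifier content of Kabanets–Impagliazzo 2003, Lemma 3 (p. 357: "if
`Perm ∈ NTIME(t)` then `P^{Perm} ⊆ NTIME(poly(n) · t(poly(n)))`", used on p. 359 with all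
`t = 2^{n^ε}`: guess the oracle answers `Y` and, for every round `j`, a certificate of the `j`-th
answer, and verify them one by one), isolated from oracle machines: the class-level derivation of
Lemma 3 for function oracles is `PRelOfFunNSUBEXP.lean`. In the tree's one-constant verifier form
of `NTIME` (`Nondeterministic.lean`) the new verifier is a genuine machine, assembled here from the
toolkit only (no machine is programmed in this file):

  `truncMapAux (clock x ↦ ⟨x, 1^{U(|x|)}⟩)` ▸ complement of
  `anyMachine (generator ▸ transT) (stripT ▸ g1Fn ▸ truncMapAux (root clock) ▸ g2Fn ▸ flag (complement M'))`

where `U(n) = clockLen p r₁ C₀ n` is the clock of `PolyExistsNTIMEClock.lean` (the whole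
certificate is cut at `U(|x|)`, the rest read two symbols per step), the generator and the round
analyser `g1Fn`, flag reader `g2Fn` are the `FP` stages of `GuardedBallStages.lean`, the root
clock `t ↦ ⟨t, 1^{c'·2^{⌊|t|^{1/r'}⌋}+c'+1}⟩` (`RootClock.lean`) cuts each sub-certificate at exactly
the admissible length of the given verifier `M'` of the member `r'` of the `NSUBEXP` presentation
of `A`, `anyMachine` (`TM2AnyList.lean`) ORs the complaints of the rounds, and the flag wrapper
(`TM2Lift.flagTM`, `TM2Simulation.lean`) lets idle rounds answer without running `M'`. The indices
are chosen `r < r + 1 = r_mid`, `r₁ = 2 d r_mid`, `r_in = r₁ + 1`, `r' = 2 e r_in` (`d`, `e` degree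
bounds of `2n + 2 + p(n)` and of `|f|` on round words) so that every cost is `2^{O(⌊n^{1/r_mid}⌋)}`
(bookkeeping `NKannan.Bnd` of `NondeterministicKannanSearch.lean`), which is eventually below
`2^{⌊n^{1/r}⌋}` (`eventually_mul_nthRoot_le`).

## References

* V. Kabanets, R. Impagliazzo, *Derandomizing polynomial identity tests means proving circuit
  lower bounds*, STOC 2003, Lemma 3 (p. 357) and proof of Thm. 18 (p. 359).
* S. Arora, B. Barak, *Computational Complexity: A Modern Approach*, CUP 2009, Def. 2.1 and
  §2.1.2 (verifier form of nondeterministic time), §1.3 (machine constructions).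
-/

namespace Literature.Computability.Complexity

open _root_.Computability Polynomial Turing Brick PRelSigPi GuardedBall

/-! ### Integer roots: comparison of different indices

(`nthRoot_anti_left`, the antitonicity in the index, is taken from `MurrayWilliams2018.lean`.) -/

/-- **A slower root eventually dominates any multiple of a faster one**: for `0 < r < r₂` and every
`D` there is `N₀` with `D · ⌊n^{1/r₂}⌋ + D ≤ ⌊n^{1/r}⌋` for all `n ≥ N₀`. (If `s₂ = ⌊n^{1/r₂}⌋ ≥ (2D+2)^r`
then `((2D+2) s₂)^r ≤ s₂^{r+1} ≤ n < (⌊n^{1/r}⌋ + 1)^r`.) [folklore] -/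
theorem eventually_mul_nthRoot_le {r r₂ : ℕ} (hr : r ≠ 0) (hrr : r < r₂) (D : ℕ) :
    ∃ N₀ : ℕ, ∀ n : ℕ, N₀ ≤ n → D * Nat.nthRoot r₂ n + D ≤ Nat.nthRoot r n := by
  have hr₂ : r₂ ≠ 0 := by omega
  refine ⟨((2 * D + 2) ^ r) ^ r₂, fun n hn => ?_⟩
  set s := Nat.nthRoot r n with hs
  set s₂ := Nat.nthRoot r₂ n with hs₂
  have hs₂ge : (2 * D + 2) ^ r ≤ s₂ := (Nat.le_nthRoot_iff hr₂).2 hn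
  have hs₂pos : 0 < s₂ := lt_of_lt_of_le (Nat.pow_pos (by omega)) hs₂ge
  have h1 : ((2 * D + 2) * s₂) ^ r ≤ s₂ ^ (r + 1) := by
    rw [mul_pow, pow_succ]
    exact Nat.mul_le_mul_right _ hs₂ge |>.trans_eq (mul_comm _ _)
  have h2 : s₂ ^ (r + 1) ≤ n :=
    (Nat.pow_le_pow_right hs₂pos (by omega)).trans (Nat.pow_nthRoot_le_iff.2 (Or.inl hr₂))
  have h3 : n < (s + 1) ^ r := Nat.lt_pow_nthRoot_add_one hr n
  have h4 : (2 * D + 2) * s₂ < s + 1 :=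
    lt_of_pow_lt_pow_left₀ r (Nat.zero_le _) (lt_of_le_of_lt (h1.trans h2) h3)
  nlinarith

/-- A polynomial factor is absorbed by passing to a strictly faster root:
`q(n) · 2^{⌊n^{1/r₂}⌋} ≤ C · 2^{⌊n^{1/r}⌋} + C` for `0 < r < r₂`. [folklore] -/
theorem exists_poly_mul_two_pow_nthRoot_le (q : Polynomial ℕ) {r r₂ : ℕ} (hr : r ≠ 0) (hrr : r < r₂) :
    ∃ C : ℕ, ∀ n : ℕ, q.eval n * 2 ^ Nat.nthRoot r₂ n ≤ C * 2 ^ Nat.nthRoot r n + C := by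
  have hr₂ : r₂ ≠ 0 := by omega
  obtain ⟨C₁, hC₁⟩ := PolyExistsNTIME.exists_poly_le_two_pow_nthRoot q hr₂
  obtain ⟨N₀, hN₀⟩ := eventually_mul_nthRoot_le hr hrr 2
  refine ⟨2 * C₁ + 2 * C₁ * 2 ^ (2 * Nat.nthRoot r₂ N₀), fun n => ?_⟩
  have hq : q.eval n ≤ 2 * C₁ * 2 ^ Nat.nthRoot r₂ n := by
    have := hC₁ n
    nlinarith [Nat.one_le_two_pow (n := Nat.nthRoot r₂ n)]
  have hsq : q.eval n * 2 ^ Nat.nthRoot r₂ n ≤ 2 * C₁ * 2 ^ (2 * Nat.nthRoot r₂ n) := by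
    calc q.eval n * 2 ^ Nat.nthRoot r₂ n ≤ 2 * C₁ * 2 ^ Nat.nthRoot r₂ n * 2 ^ Nat.nthRoot r₂ n :=
          Nat.mul_le_mul_right _ hq
      _ = 2 * C₁ * 2 ^ (2 * Nat.nthRoot r₂ n) := by rw [two_mul (Nat.nthRoot r₂ n), pow_add]; ring
  rcases le_or_gt N₀ n with hn | hn
  · have h := hN₀ n hn
    have hpow : 2 ^ (2 * Nat.nthRoot r₂ n) ≤ 2 ^ Nat.nthRoot r n :=
      Nat.pow_le_pow_right Nat.two_pos (by omega)
    calc q.eval n * 2 ^ Nat.nthRoot r₂ n ≤ 2 * C₁ * 2 ^ (2 * Nat.nthRoot r₂ n) := hsq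
      _ ≤ 2 * C₁ * 2 ^ Nat.nthRoot r n := Nat.mul_le_mul_left _ hpow
      _ ≤ (2 * C₁ + 2 * C₁ * 2 ^ (2 * Nat.nthRoot r₂ N₀)) * 2 ^ Nat.nthRoot r n := 
          Nat.mul_le_mul_right _ (Nat.le_add_right _ _)
      _ ≤ _ := Nat.le_add_right _ _
  · have hmono : Nat.nthRoot r₂ n ≤ Nat.nthRoot r₂ N₀ := PolyExistsNTIME.nthRoot_mono_right hr₂ hn.le
    have hpow : 2 ^ (2 * Nat.nthRoot r₂ n) ≤ 2 ^ (2 * Nat.nthRoot r₂ N₀) :=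
      Nat.pow_le_pow_right Nat.two_pos (by omega)
    calc q.eval n * 2 ^ Nat.nthRoot r₂ n ≤ 2 * C₁ * 2 ^ (2 * Nat.nthRoot r₂ n) := hsq
      _ ≤ 2 * C₁ * 2 ^ (2 * Nat.nthRoot r₂ N₀) := Nat.mul_le_mul_left _ hpow
      _ ≤ 2 * C₁ + 2 * C₁ * 2 ^ (2 * Nat.nthRoot r₂ N₀) := Nat.le_add_left _ _
      _ ≤ _ := Nat.le_add_left _ _

/-- Degree bounds with a positive exponent: every polynomial is `≤ A · n^e + A` with `e ≠ 0`. [folklore] -/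
theorem exists_eval_le_mul_pow_add_pos (q : Polynomial ℕ) :
    ∃ A e : ℕ, e ≠ 0 ∧ ∀ n : ℕ, q.eval n ≤ A * n ^ e + A := by
  obtain ⟨c, k, h⟩ := exists_eval_le_mul_pow_add q
  refine ⟨2 * c, k + 1, Nat.succ_ne_zero k, fun n => ?_⟩
  have hk : n ^ k ≤ n ^ (k + 1) + 1 := by
    rcases Nat.eq_zero_or_pos n with rfl | hn
    · cases k <;> simp
    · exact (Nat.pow_le_pow_right hn (Nat.le_succ k)).trans (Nat.le_succ _)
  calc q.eval n ≤ c * n ^ k + c := h n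
    _ ≤ c * (n ^ (k + 1) + 1) + c := by gcongr
    _ = c * n ^ (k + 1) + 2 * c := by ring
    _ ≤ 2 * c * n ^ (k + 1) + 2 * c := by rw [mul_assoc, two_mul]; omega

/-! ### Two machine wrappers: flagged dispatch and complement -/

/-- **The flag wrapper** of `M : TM2ComputableAux Bool Bool` (`TM2Lift.flagTM`): on `1 l` it runs `M`
on `l`, on `0 b` it answers the hard-wired word `ans b`. [cite: AroraBarakCC2009, §1.3 (machine constructions)] -/
def flagAux (M : TM2ComputableAux Bool Bool) (ans : Bool → List Bool) : TM2ComputableAux Bool Bool :=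
  ⟨TM2Lift.flagTM M.tm M.inputAlphabet (fun b => (ans b).map M.outputAlphabet.symm), M.inputAlphabet,
    M.outputAlphabet⟩

/-- The direct answer of the flag wrapper: `0 b ↦ ans b` in two steps. [folklore] -/
theorem flagAux_outputsWithin_answer (M : TM2ComputableAux Bool Bool) (ans : Bool → List Bool) (b : Bool) :
    (flagAux M ans).OutputsWithin [false, b] (ans b) 2 := by
  refine TM2Iter.outputsWithin_of_reachesIn _ ⟨2, le_rfl, ?_⟩
  exact TM2Lift.flagTM_answer M.tm M.inputAlphabet (fun b => (ans b).map M.outputAlphabet.symm) b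

/-- The pass-through of the flag wrapper: `1 l ↦ M(l)` in one more step than `M`. [folklore] -/
theorem flagAux_outputsWithin_run (M : TM2ComputableAux Bool Bool) (ans : Bool → List Bool)
    {l l' : List Bool} {m : ℕ} (h : M.OutputsWithin l l' m) :
    (flagAux M ans).OutputsWithin (true :: l) l' (m + 1) := by
  obtain ⟨n, hn, e⟩ := TM2Iter.reachesIn_of_outputsWithin M h
  refine TM2Iter.outputsWithin_of_reachesIn _ ⟨n + 1, by omega, ?_⟩
  exact TM2Lift.flagTM_passThrough M.tm M.inputAlphabet (fun b => (ans b).map M.outputAlphabet.symm) _ _ n e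

/-- The complement machine flips a one-bit answer, in the same time. [cite: AroraBarakCC2009, §2.6.1] -/
theorem complMachine_outputsWithin {Γ₀ : Type} {M : TM2ComputableAux Γ₀ Bool} {l : List Γ₀} {b : Bool}
    {m : ℕ} (h : M.OutputsWithin l [b] m) : (complMachine M).OutputsWithin l [!b] m := by
  have := h.outputAlphabet_trans Equiv.boolNot
  simpa [complMachine] using this

/-! ### The round machine -/

/-- **The admissible certificate length** `c' · 2^{⌊m^{1/r'}⌋} + c'` of an `NTIME(2^{⌊m^{1/r'}⌋})`
verifier with constant `c'`. [cite: AroraBarakCC2009, Def. 2.1 and §2.1.2] -/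
def admLen (r' c' m : ℕ) : ℕ := c' * 2 ^ Nat.nthRoot r' m + c'

/-- The root clock length is the admissible length plus one (the flag symbol). [folklore] -/
theorem rootClockLen_eq (r' c' m : ℕ) : rootClockLen r' c' m = admLen r' c' m + 1 := rfl

section RoundMachine

variable (R S : Language Bool) (f : List Bool → List Bool) (p : Polynomial ℕ)
  (R' : List Bool → List Bool → Bool) (r' c' : ℕ)

open Classical in
/-- **The complaint bit of a round** `⟨⟨w, J⟩, z⟩`, `w = ⟨x, Y⟩`: a failed guard complains; a
guarded round in `S` complains iff the inner relation rejects the query `f ⟨w, J⟩` with the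
certificate `z` cut to admissible length; other rounds do not complain. [folklore] -/
noncomputable def qbit (x Y J z : List Bool) : Bool :=
  if Y.length ≤ p.eval x.length ∧ boolPair x Y ∈ R then
    if boolPair (boolPair x Y) J ∈ S then
      !R' (f (boolPair (boolPair x Y) J))
        (z.take (admLen r' c' (f (boolPair (boolPair x Y) J)).length))
    else false
  else true

variable {R S f r'}

/-- **The round machine.** Given the verifier `M'` of the inner relation `R'` (specified on pairs
`⟨t, z⟩` with `|z| ≤ admLen r' c' |t|`, within that many steps), some machine maps the marked round
word `(⟨⟨⟨x, Y⟩, J⟩, z⟩).map some` to the complaint bit, within `Q(|round word|) + K · 2^{⌊|t|^{1/r'}⌋}`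
steps, `t = g1T …` the clock word of the round (`stripT ▸ g1Fn ▸ truncMapAux (root clock) ▸ g2Fn ▸
flag (complement M')`). [cite: KabanetsImpagliazzo2003, Lemma 3 (p. 357)] -/
theorem exists_roundMachine (hR : R ∈ Classes.P) (hS : S ∈ Classes.P) (hf : f ∈ FP) (hr' : r' ≠ 0)
    (M' : TM2ComputableAux Bool Bool)
    (hM' : ∀ t z : List Bool, z.length ≤ admLen r' c' t.length →
      M'.OutputsWithin (boolPair t z) (encodeBool (R' t z)) (admLen r' c' t.length)) :
    ∃ (Q : Polynomial ℕ) (K : ℕ) (M₂ : TM2ComputableAux (Option Bool) Bool), ∀ x Y J z : List Bool,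
      M₂.OutputsWithin ((boolPair (boolPair (boolPair x Y) J) z).map some)
        [qbit R S f p R' r' c' x Y J z]
        (Q.eval (boolPair (boolPair (boolPair x Y) J) z).length +
          K * 2 ^ Nat.nthRoot r' (g1T R S f p x Y J).length) := by
  classical
  obtain ⟨MS, hMS⟩ := NKannan.stripT.exists_outputsWithin
  obtain ⟨p1, M1, hM1⟩ := g1Fn_mem_FP R S f p hR hS hf
  obtain ⟨Pr, Kr, Nrt, hNrt⟩ := exists_rootClock_machine hr' c'
  obtain ⟨p2, M2, hM2⟩ := g2Fn_mem_FP
  obtain ⟨pf, hpf⟩ := exists_poly_length_le_of_mem_FP hf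
  let MF : TM2ComputableAux Bool Bool := flagAux (complMachine M') fun b => [b]
  refine ⟨Polynomial.C (NKannan.stripT.maxEmit + 1) * X + Polynomial.C 3 + p1 +
      (Pr.comp (pf + 1) + Polynomial.C 5 * (pf + 1) + Polynomial.C (2 * c' + 2) + (X + 1) + Polynomial.C 11) +
      p2.comp (Polynomial.C 2 * (pf + 1) + Polynomial.C 2 + X + 1) + Polynomial.C (c' + 2),
    Kr + 2 * c' + c', MS.comp (M1.comp ((truncMapAux Nrt).comp (M2.comp MF))), fun x Y J z => ?_⟩
  set u := boolPair (boolPair (boolPair x Y) J) z with hu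
  set t := g1T R S f p x Y J with ht
  set u₁ := g1U R S p x Y J z with hu₁
  set L := rootClockLen r' c' t.length with hL
  -- the five stages
  have h1 : MS.OutputsWithin (u.map some) u ((NKannan.stripT.maxEmit + 1) * u.length + 3) := by
    have := hMS (u.map some)
    rwa [NKannan.stripT_eval_map_some, List.length_map] at this
  have h2 : M1.OutputsWithin u (boolPair t u₁) (p1.eval u.length) := by
    have := hM1 u
    rwa [hu, g1Fn_apply] at this
  have h3 : (truncMapAux Nrt).OutputsWithin (boolPair t u₁) (boolPair t (u₁.take L))
      ((Pr.eval t.length + Kr * 2 ^ Nat.nthRoot r' t.length) + 3 * t.length + 2 * L + 2 * t.length +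
        u₁.length / 2 + 11) := by
    have := outputsWithin_truncMapAux_boolPair Nrt (y := u₁) (hNrt t)
    simpa [rootClock, hL] using this
  -- lengths
  have htlen : t.length ≤ pf.eval u.length + 1 := by
    refine (length_g1T_le R S f p x Y J).trans ?_
    split_ifs
    · refine Nat.add_le_add_right ((hpf _).trans (TM2Iter.eval_mono pf ?_)) 1
      simp only [hu, length_boolPair]; omega
    · exact Nat.succ_le_succ (Nat.zero_le _)
  have hu₁len : u₁.length ≤ u.length + 1 := by
    refine (length_g1U_le R S p x Y J z).trans ?_
    simp only [hu, length_boolPair]; omega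
  have hLeq : L = admLen r' c' t.length + 1 := rfl
  have hLle : L ≤ c' * 2 ^ Nat.nthRoot r' t.length + c' + 1 := le_rfl
  -- the last two stages, by cases on the round
  have h45 : (M2.comp MF).OutputsWithin (boolPair t (u₁.take L)) [qbit R S f p R' r' c' x Y J z]
      ((2 + admLen r' c' t.length) + p2.eval (boolPair t (u₁.take L)).length) := by
    by_cases hg : Y.length ≤ p.eval x.length ∧ boolPair x Y ∈ R
    · by_cases hs : boolPair (boolPair x Y) J ∈ S
      · -- a task: run the inner verifier on the cut certificate
        have htq : t = f (boolPair (boolPair x Y) J) := by simp [ht, g1T, hg, hs]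
        have hkept : u₁.take L = true :: z.take (admLen r' c' t.length) := by
          simp [hu₁, g1U, hg, hs, hLeq, List.take_succ_cons]
        have h4 : M2.OutputsWithin (boolPair t (u₁.take L)) (true :: boolPair t (z.take (admLen r' c' t.length)))
            (p2.eval (boolPair t (u₁.take L)).length) := by
          have := hM2 (boolPair t (u₁.take L))
          rwa [hkept, g2Fn_true, ← hkept] at this
        have h5 : MF.OutputsWithin (true :: boolPair t (z.take (admLen r' c' t.length)))
            [qbit R S f p R' r' c' x Y J z] (admLen r' c' t.length + 1) := by
          have hz : (z.take (admLen r' c' t.length)).length ≤ admLen r' c' t.length := List.length_take_le _ _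
          have hm := complMachine_outputsWithin (hM' t _ hz)
          have hq : qbit R S f p R' r' c' x Y J z = !R' t (z.take (admLen r' c' t.length)) := by
            simp [qbit, hg, hs, htq]
          rw [hq]
          exact flagAux_outputsWithin_run _ _ hm
        exact (TM2ComputableAux.comp_outputsWithin _ _ h4 h5).mono (by omega)
      · -- an idle round
        have htq : t = [false] := by simp [ht, g1T, hg, hs]
        have hkept : u₁.take L = [false] := by simp [hu₁, g1U, hg, hs, hLeq]
        have h4 : M2.OutputsWithin (boolPair t (u₁.take L)) [false, false] (p2.eval (boolPair t (u₁.take L)).length) := by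
          have hhd : t.headD false = false := by rw [htq]; rfl
          have := hM2 (boolPair t [false])
          simp only [id, g2Fn_false, hhd] at this
          rw [hkept]
          exact this
        have h5 : MF.OutputsWithin [false, false] [qbit R S f p R' r' c' x Y J z] 2 := by
          have hq : qbit R S f p R' r' c' x Y J z = false := by simp [qbit, hg, hs]
          rw [hq]
          exact flagAux_outputsWithin_answer _ _ false
        exact (TM2ComputableAux.comp_outputsWithin _ _ h4 h5).mono (by omega)
    · -- a failed guard complains
      have htq : t = [true] := by simp [ht, g1T, hg]
      have hkept : u₁.take L = [false] := by simp [hu₁, g1U, hg, hLeq]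
      have h4 : M2.OutputsWithin (boolPair t (u₁.take L)) [false, true] (p2.eval (boolPair t (u₁.take L)).length) := by
        have hhd : t.headD false = true := by rw [htq]; rfl
        have := hM2 (boolPair t [false])
        simp only [id, g2Fn_false, hhd] at this
        rw [hkept]
        exact this
      have h5 : MF.OutputsWithin [false, true] [qbit R S f p R' r' c' x Y J z] 2 := by
        have hq : qbit R S f p R' r' c' x Y J z = true := by simp [qbit, hg]
        rw [hq]
        exact flagAux_outputsWithin_answer _ _ true
      exact (TM2ComputableAux.comp_outputsWithin _ _ h4 h5).mono (by omega)
  have h345 := TM2ComputableAux.comp_outputsWithin _ _ h3 h45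
  have h2345 := TM2ComputableAux.comp_outputsWithin _ _ h2 h345
  have h := TM2ComputableAux.comp_outputsWithin _ _ h1 h2345
  refine h.mono ?_
  -- the time estimate
  have hkeptlen : (boolPair t (u₁.take L)).length ≤ 2 * (pf.eval u.length + 1) + 2 + u.length + 1 := by
    rw [length_boolPair]
    have := List.length_take_le' L u₁
    omega
  have hPr : Pr.eval t.length ≤ (Pr.comp (pf + 1)).eval u.length := by
    rw [eval_comp, eval_add, eval_one]; exact TM2Iter.eval_mono Pr htlen
  have hp2 : p2.eval (boolPair t (u₁.take L)).length ≤
      (p2.comp (Polynomial.C 2 * (pf + 1) + Polynomial.C 2 + X + 1)).eval u.length := by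
    rw [eval_comp]
    refine TM2Iter.eval_mono p2 ?_
    simpa using hkeptlen
  have hdiv : u₁.length / 2 ≤ u.length + 1 := (Nat.div_le_self _ _).trans hu₁len
  simp only [eval_add, eval_mul, eval_C, eval_X, eval_one, admLen] at hPr hp2 ⊢
  nlinarith [hPr, hp2, hdiv, htlen, hLle, Nat.zero_le (2 ^ Nat.nthRoot r' t.length)]

end RoundMachine

/-! ### The generator machine and the checking machine -/

section CheckMachine

variable (R S : Language Bool) (f : List Bool → List Bool) (p : Polynomial ℕ)
  (R' : List Bool → List Bool → Bool) (r' c' : ℕ)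

/-- **The generator machine** (`genFn ▸ transT`): on `⟨x, c⟩` it writes the `none`-terminated list
of the marked round words `(item x c j).map some`, `j < |⟨x, fstF c⟩|`, in polynomial time. [folklore] -/
theorem exists_genMachine :
    ∃ (Q : Polynomial ℕ) (M₁ : TM2ComputableAux Bool (Option Bool)), ∀ x c : List Bool,
      M₁.OutputsWithin (boolPair x c)
        ((List.range (boolPair x (fstF c)).length).flatMap fun j => (item x c j).map some ++ [none])
        (Q.eval (boolPair x c).length) := by
  obtain ⟨pG, MG, hMG⟩ := genFn_mem_FP
  obtain ⟨MT, hMT⟩ := NKannan.transT.exists_outputsWithin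
  obtain ⟨sG, hsG⟩ := exists_poly_length_le_of_mem_FP genFn_mem_FP
  refine ⟨Polynomial.C (NKannan.transT.maxEmit + 1) * sG + Polynomial.C 3 + pG, MG.comp MT, fun x c => ?_⟩
  have h1 : MG.OutputsWithin (boolPair x c) (genFn (boolPair x c)) (pG.eval (boolPair x c).length) := hMG _
  have h2 := hMT (genFn (boolPair x c))
  have hev : NKannan.transT.eval (genFn (boolPair x c)) =
      (List.range (boolPair x (fstF c)).length).flatMap fun j => (item x c j).map some ++ [none] := by
    rw [genFn_boolPair_eq_flatMap, NKannan.transT_eval_flatMap, List.flatMap_map]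
  rw [hev] at h2
  refine (TM2ComputableAux.comp_outputsWithin _ _ h1 h2).mono ?_
  have hl := hsG (boolPair x c)
  simp only [eval_add, eval_mul, eval_C]
  nlinarith

/-- The round words are short: `|item x c j| ≤ 7 |⟨x, c⟩| + 6` for `j < |⟨x, fstF c⟩|`. [folklore] -/
theorem length_item_le (x c : List Bool) {j : ℕ} (hj : j < (boolPair x (fstF c)).length) :
    (item x c j).length ≤ 7 * (boolPair x c).length + 6 := by
  have h1 := length_fstF_sndF_le c
  have h2 := length_elemOf_le (sndF c) j
  simp only [item, length_boolPair, ones, List.length_replicate] at hj ⊢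
  omega

/-- The guarded word is within the input: `|⟨x, fstF c⟩| ≤ |⟨x, c⟩|`. [folklore] -/
theorem length_w_le (x c : List Bool) : (boolPair x (fstF c)).length ≤ (boolPair x c).length := by
  have h1 := length_fstF_sndF_le c
  simp only [length_boolPair]
  omega

variable {R S f r'}

/-- **The checking machine** (complement of `anyMachine (generator) (round machine)`): on `⟨x, c⟩`
it answers `1` iff no round `j < |⟨x, fstF c⟩|` complains, within
`Q(|⟨x, c⟩|) + |⟨x, c⟩| · K · 2^{⌊B^{1/r'}⌋}` steps whenever every clock word of these rounds has
length `≤ B`. [cite: KabanetsImpagliazzo2003, Lemma 3 (p. 357)] -/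
theorem exists_checkMachine (hR : R ∈ Classes.P) (hS : S ∈ Classes.P) (hf : f ∈ FP) (hr' : r' ≠ 0)
    (M' : TM2ComputableAux Bool Bool)
    (hM' : ∀ t z : List Bool, z.length ≤ admLen r' c' t.length →
      M'.OutputsWithin (boolPair t z) (encodeBool (R' t z)) (admLen r' c' t.length)) :
    ∃ (Q : Polynomial ℕ) (K : ℕ) (D : TM2ComputableAux Bool Bool), ∀ (x c : List Bool) (B : ℕ),
      (∀ j < (boolPair x (fstF c)).length, (g1T R S f p x (fstF c) (ones j)).length ≤ B) →
      D.OutputsWithin (boolPair x c)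
        [!((List.range (boolPair x (fstF c)).length).any fun j =>
            qbit R S f p R' r' c' x (fstF c) (ones j) (elemOf (sndF c) j))]
        (Q.eval (boolPair x c).length + (boolPair x c).length * (K * 2 ^ Nat.nthRoot r' B)) := by
  obtain ⟨QG, M₁, hM₁⟩ := exists_genMachine
  obtain ⟨Q₂, K, M₂, hM₂⟩ := exists_roundMachine p R' c' hR hS hf hr' M' hM'
  refine ⟨QG + X * (Q₂.comp (Polynomial.C 7 * X + Polynomial.C 6) + Polynomial.C 14 * X + Polynomial.C 15) +
      Polynomial.C 2, K, complMachine (M₁.anyMachine M₂ none), fun x c B hB => ?_⟩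
  set k := (boolPair x (fstF c)).length with hk
  set W := (boolPair x c).length with hW
  have hw : ∀ j : ℕ, (none : Option Bool) ∉ (item x c j).map some := fun j => by simp
  have hany := TM2ComputableAux.any_outputsWithin M₁ M₂ (sep := none)
    (w := fun j => (item x c j).map some)
    (q := fun j => qbit R S f p R' r' c' x (fstF c) (ones j) (elemOf (sndF c) j))
    (m := fun j => Q₂.eval (item x c j).length +
      K * 2 ^ Nat.nthRoot r' (g1T R S f p x (fstF c) (ones j)).length)
    hw (bs := List.range k) (hM₁ x c) (fun j => hM₂ x (fstF c) (ones j) (elemOf (sndF c) j))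
  refine (complMachine_outputsWithin hany).mono ?_
  -- the sum over the rounds
  have hkW : k ≤ W := length_w_le x c
  have hterm : ∀ j ∈ List.range k,
      (Q₂.eval (item x c j).length + K * 2 ^ Nat.nthRoot r' (g1T R S f p x (fstF c) (ones j)).length) +
          2 * ((item x c j).map some).length + 3 ≤
        Q₂.eval (7 * W + 6) + K * 2 ^ Nat.nthRoot r' B + (14 * W + 15) := by
    intro j hj
    rw [List.mem_range] at hj
    have hit := length_item_le x c hj
    have hq : Q₂.eval (item x c j).length ≤ Q₂.eval (7 * W + 6) := TM2Iter.eval_mono Q₂ hit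
    have hB' : 2 ^ Nat.nthRoot r' (g1T R S f p x (fstF c) (ones j)).length ≤ 2 ^ Nat.nthRoot r' B :=
      Nat.pow_le_pow_right Nat.two_pos (PolyExistsNTIME.nthRoot_mono_right hr' (hB j hj))
    rw [List.length_map]
    nlinarith [Nat.mul_le_mul_left K hB']
  have hsum := List.sum_le_card_nsmul _ _ (fun t ht => by
    obtain ⟨j, hj, rfl⟩ := List.mem_map.1 ht
    exact hterm j hj)
  rw [List.length_map, List.length_range, smul_eq_mul] at hsum
  have hQ : Q₂.eval (7 * W + 6) = (Q₂.comp (Polynomial.C 7 * X + Polynomial.C 6)).eval W := by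
    simp [eval_comp]
  simp only [eval_add, eval_mul, eval_C, eval_X, eval_comp] at hQ ⊢
  have hkmul : k * (Q₂.eval (7 * W + 6) + K * 2 ^ Nat.nthRoot r' B + (14 * W + 15)) ≤
      W * (Q₂.eval (7 * W + 6) + K * 2 ^ Nat.nthRoot r' B + (14 * W + 15)) := Nat.mul_le_mul_right _ hkW
  nlinarith [hsum, hkmul]

end CheckMachine

/-! ### The outer clock: the clock program of `PolyExistsNTIMEClock.lean` -/

/-- The Horner value is a polynomial in the evaluation point. [folklore] -/
theorem exists_hornerVal_poly (ds : List ℕ) :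
    ∃ H : Polynomial ℕ, ∀ k : ℕ, PolyExistsNTIME.hornerVal k ds = H.eval k := by
  induction ds with
  | nil => exact ⟨0, fun k => by simp [PolyExistsNTIME.hornerVal]⟩
  | cons c ds ih =>
    obtain ⟨H, hH⟩ := ih
    exact ⟨Polynomial.C c + X * H, fun k => by simp [PolyExistsNTIME.hornerVal, hH]⟩

/-- The cost of the Horner stage is polynomially bounded in the evaluation point. [folklore] -/
theorem exists_cHorner_le (ds : List ℕ) :
    ∃ P : Polynomial ℕ, ∀ k : ℕ, PolyExistsNTIME.cHorner k ds ≤ P.eval k := by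
  induction ds with
  | nil => exact ⟨0, fun k => by simp [PolyExistsNTIME.cHorner]⟩
  | cons c ds ih =>
    obtain ⟨P, hP⟩ := ih
    obtain ⟨H, hH⟩ := exists_hornerVal_poly ds
    refine ⟨P + ((Polynomial.C 7 * X + Polynomial.C 4) * H + Polynomial.C 3 * (H * X) + Polynomial.C 2) +
      Polynomial.C c, fun k => ?_⟩
    have := hP k
    simp only [PolyExistsNTIME.cHorner, hH, eval_add, eval_mul, eval_C, eval_X]
    omega

/-- **The clock program of `PolyExistsNTIMEClock.lean` runs in time `poly(n) + O(2^{⌊m(n)^{1/r₁}⌋})`**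
(`m(n) = 2n + 2 + p(n)`): `cClock p r₁ C₀ n + 1 ≤ P(n) + K · 2^{rootM p r₁ n}`. [folklore] -/
theorem exists_cClock_le (p : Polynomial ℕ) (r₁ C₀ : ℕ) :
    ∃ (P : Polynomial ℕ) (K : ℕ), ∀ n : ℕ,
      PolyExistsNTIME.cClock p r₁ C₀ n + 1 ≤ P.eval n + K * 2 ^ PolyExistsNTIME.rootM p r₁ n := by
  obtain ⟨Hc, hHc⟩ := exists_cHorner_le (PolyExistsNTIME.coeffList p)
  set L : Polynomial ℕ := Polynomial.C 2 * X + Polynomial.C 2 + p with hL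
  set I : Polynomial ℕ := (ExpPad.cPowPoly r₁).comp (X + 1) + Polynomial.C 8 * (X + 1) ^ r₁ + Polynomial.C 11
    with hI
  refine ⟨Polynomial.C 4 * X + Polynomial.C 1 + Hc + (Polynomial.C 4 * X + Polynomial.C 7 * p + Polynomial.C 5) +
      Polynomial.C 1 + ((L + Polynomial.C 2) * (I.comp L + Polynomial.C 2) + Polynomial.C 1) + Polynomial.C 1 +
      (Polynomial.C 1 + Polynomial.C C₀ + (Polynomial.C 4 * p + Polynomial.C 1) + Polynomial.C 2) +
      (Polynomial.C 4 * X + Polynomial.C 3) + (Polynomial.C 2 * L + Polynomial.C 1) + Polynomial.C 1,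
    C₀ + 16, fun n => ?_⟩
  have hexp := ExpPad.cExp_eq (PolyExistsNTIME.rootM p r₁ n) 1
  set s := PolyExistsNTIME.rootM p r₁ n with hs
  have hs2 : s ≤ 2 ^ s := Nat.lt_two_pow_self.le
  have h1 : 1 ≤ 2 ^ s := Nat.one_le_two_pow
  have hlen : PolyExistsNTIME.lenM p n = L.eval n := by simp [PolyExistsNTIME.lenM, hL]
  have hiter : PolyExistsNTIME.cRootIter r₁ (L.eval n) = I.eval (L.eval n) := by
    simp [PolyExistsNTIME.cRootIter, hI, ExpPad.eval_cPowPoly]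
  have hH := hHc n
  simp only [PolyExistsNTIME.cClock, ← hs, hlen, hiter]
  simp only [eval_add, eval_mul, eval_C, eval_X, eval_comp]
  nlinarith [hexp, h1, hs2, hH]

/-- **The outer clock machine**: `x ↦ ⟨x, 1^{clockLen p r₁ C₀ |x|}⟩` within `cClock p r₁ C₀ |x| + 1`
steps (the structured program `PolyExistsNTIME.clockProg`, compiled by `ACom.exists_computesInTime`).
[folklore] -/
theorem exists_outerClock_machine (p : Polynomial ℕ) {r₁ : ℕ} (hr₁ : r₁ ≠ 0) (C₀ : ℕ) :
    ∃ N : TM2ComputableAux Bool Bool, ∀ x : List Bool,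
      N.OutputsWithin x (boolPair x (List.replicate (PolyExistsNTIME.clockLen p r₁ C₀ x.length) true))
        (PolyExistsNTIME.cClock p r₁ C₀ x.length + 1) := by
  obtain ⟨N, hN⟩ := ACom.exists_computesInTime (PolyExistsNTIME.clockProg p r₁ C₀) .inp .out
    (id : List Bool → List Bool) (id : List Bool → List Bool)
    (fun x => boolPair x (List.replicate (PolyExistsNTIME.clockLen p r₁ C₀ x.length) true))
    (fun x => PolyExistsNTIME.cClock p r₁ C₀ x.length) (PolyExistsNTIME.runs_clockProg p hr₁ C₀)
  exact ⟨N, hN⟩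

/-! ### The guarded ball and its membership in `NSUBEXP` -/

/-- **The guarded ball** of `A` along `(R, S, f, p)`: the inputs `x` admitting a polynomial guess `Y`
(`|Y| ≤ p(|x|)`) with `⟨x, Y⟩ ∈ R` such that every round `j < |⟨x, Y⟩|` passing the guard
`⟨⟨x, Y⟩, 1ʲ⟩ ∈ S` has its query `f ⟨⟨x, Y⟩, 1ʲ⟩` in `A`. (The shape of "guess the oracle answers and
verify each of them", Kabanets–Impagliazzo 2003, Lemma 3.) [cite: KabanetsImpagliazzo2003, Lemma 3 (p. 357)] -/
def guardedBall (A R S : Language Bool) (f : List Bool → List Bool) (p : Polynomial ℕ) : Language Bool :=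
  {x | ∃ Y : List Bool, Y.length ≤ p.eval x.length ∧ boolPair x Y ∈ R ∧
    ∀ j < (boolPair x Y).length, boolPair (boolPair x Y) (ones j) ∈ S →
      f (boolPair (boolPair x Y) (ones j)) ∈ A}

/-- Membership in the guarded ball (definitional unfolding). [folklore] -/
theorem mem_guardedBall_iff {A R S : Language Bool} {f : List Bool → List Bool} {p : Polynomial ℕ}
    {x : List Bool} :
    x ∈ guardedBall A R S f p ↔ ∃ Y : List Bool, Y.length ≤ p.eval x.length ∧ boolPair x Y ∈ R ∧
      ∀ j < (boolPair x Y).length, boolPair (boolPair x Y) (ones j) ∈ S →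
        f (boolPair (boolPair x Y) (ones j)) ∈ A :=
  Iff.rfl

/-- The input length is `2^{O(⌊n^{1/r}⌋)}` (bookkeeping form). [folklore] -/
theorem bnd_self {rm : ℕ} (hrm : rm ≠ 0) : NKannan.Bnd (fun n => Nat.nthRoot rm n + 1) fun n => n := by
  obtain ⟨C, hC⟩ := PolyExistsNTIME.exists_poly_le_two_pow_nthRoot (X : Polynomial ℕ) hrm
  refine ⟨C + 1, fun n => ?_⟩
  have h := hC n
  simp only [eval_X] at h
  have hC2 : C ≤ 2 ^ C := Nat.lt_two_pow_self.le
  have h1 : 1 ≤ 2 ^ Nat.nthRoot rm n := Nat.one_le_two_pow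
  calc n ≤ C * 2 ^ Nat.nthRoot rm n + C := h
    _ ≤ 2 ^ C * 2 ^ Nat.nthRoot rm n + 2 ^ C * 2 ^ Nat.nthRoot rm n := by nlinarith
    _ = 2 ^ (C + Nat.nthRoot rm n + 1) := by rw [pow_add, pow_succ]; ring
    _ ≤ 2 ^ ((C + 1) * (Nat.nthRoot rm n + 1)) := Nat.pow_le_pow_right Nat.two_pos (by nlinarith)

/-! ### The relation of the verifier: completeness and soundness -/

section Relation

variable (R S : Language Bool) (f : List Bool → List Bool) (p : Polynomial ℕ)
  (R' : List Bool → List Bool → Bool) (r' c' : ℕ)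

/-- **The relation computed by the verifier**: cut the certificate `y` at the clock `U(|x|)`, read it
as `⟨Y, Zs⟩`, and accept iff no round `j < |⟨x, Y⟩|` complains. [folklore] -/
noncomputable def relOf (U : ℕ → ℕ) (x y : List Bool) : Bool :=
  !((List.range (boolPair x (fstF (y.take (U x.length)))).length).any fun j =>
    qbit R S f p R' r' c' x (fstF (y.take (U x.length))) (ones j) (elemOf (sndF (y.take (U x.length))) j))

variable {R S f p R' r' c'} {A : Language Bool}

/-- **Soundness of the relation**: an accepted pair has its cut guess `Y` in the guarded ball's
witness set — a failed guard would complain in round `0`, and in a guarded round of `S` the inner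
relation accepts a certificate of admissible length, so the query is in `A`. [cite: KabanetsImpagliazzo2003, Lemma 3 (p. 357)] -/
theorem relOf_sound (hAiff : ∀ t, t ∈ A ↔ ∃ z, z.length ≤ admLen r' c' t.length ∧ R' t z = true)
    {U : ℕ → ℕ} {x y : List Bool} (h : relOf R S f p R' r' c' U x y = true) :
    x ∈ guardedBall A R S f p := by
  classical
  set c := y.take (U x.length) with hc
  set Y := fstF c with hY
  have hall : ∀ j < (boolPair x Y).length, qbit R S f p R' r' c' x Y (ones j) (elemOf (sndF c) j) = false := by
    intro j hj
    simp only [relOf, ← hc, ← hY, Bool.not_eq_true', List.any_eq_false, List.mem_range] at h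
    simpa using h j hj
  have h0 := hall 0 (by rw [length_boolPair]; omega)
  have hg : Y.length ≤ p.eval x.length ∧ boolPair x Y ∈ R := by
    by_contra hg
    simp [qbit, hg] at h0
  refine ⟨Y, hg.1, hg.2, fun j hj hjS => ?_⟩
  have hq := hall j hj
  simp only [qbit, hg, and_self, if_true, hjS, Bool.not_eq_false'] at hq
  exact (hAiff _).2 ⟨_, List.length_take_le _ _, hq⟩

/-- **Completeness of the relation**: a member of the guarded ball with guess `Y` is accepted with
the certificate `⟨Y, body zs⟩`, `zs` the list of honest certificates of the queries of the guarded
rounds (of admissible length), as soon as the clock does not cut it. [cite: KabanetsImpagliazzo2003, Lemma 3 (p. 357)] -/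
theorem relOf_complete (hAiff : ∀ t, t ∈ A ↔ ∃ z, z.length ≤ admLen r' c' t.length ∧ R' t z = true)
    {x : List Bool} (hx : x ∈ guardedBall A R S f p) :
    ∃ (Y : List Bool) (zs : List (List Bool)),
      Y.length ≤ p.eval x.length ∧ zs.length = (boolPair x Y).length ∧
      (∀ z ∈ zs, ∃ j < (boolPair x Y).length,
        z.length ≤ admLen r' c' (f (boolPair (boolPair x Y) (ones j))).length) ∧
      ∀ U : ℕ → ℕ, (boolPair Y (OracleCompose.body zs)).length ≤ U x.length →
        relOf R S f p R' r' c' U x (boolPair Y (OracleCompose.body zs)) = true := by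
  classical
  obtain ⟨Y, hY, hxR, hall⟩ := hx
  set w := boolPair x Y with hw
  set k := w.length with hk
  have hex : ∀ j : ℕ, ∃ z : List Bool, z.length ≤ admLen r' c' (f (boolPair w (ones j))).length ∧
      (j < k → boolPair w (ones j) ∈ S → R' (f (boolPair w (ones j))) z = true) := by
    intro j
    by_cases hj : j < k ∧ boolPair w (ones j) ∈ S
    · obtain ⟨z, hz, hRz⟩ := (hAiff _).1 (hall j hj.1 hj.2)
      exact ⟨z, hz, fun _ _ => hRz⟩
    · exact ⟨[], Nat.zero_le _, fun h1 h2 => absurd ⟨h1, h2⟩ hj⟩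
  choose zf hzf hRzf using hex
  refine ⟨Y, (List.range k).map zf, hY, by simp [hk, hw], ?_, fun U hU => ?_⟩
  · intro z hz
    obtain ⟨j, hj, rfl⟩ := List.mem_map.1 hz
    exact ⟨j, List.mem_range.1 hj, hzf j⟩
  · have htake : (boolPair Y (OracleCompose.body ((List.range k).map zf))).take (U x.length) =
        boolPair Y (OracleCompose.body ((List.range k).map zf)) := List.take_of_length_le hU
    simp only [relOf, htake, fstF_boolPair, sndF_boolPair, ← hw, ← hk, Bool.not_eq_true',
      List.any_eq_false, List.mem_range]
    intro j hj
    have hel : elemOf (OracleCompose.body ((List.range k).map zf)) j = zf j := by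
      rw [elemOf_body, List.getD_eq_getElem _ _ (by simpa using hj)]
      simp
    rw [hel]
    simp only [qbit, ← hw, hY, hxR, and_self, if_true]
    by_cases hjS : boolPair w (ones j) ∈ S
    · rw [if_pos hjS, List.take_of_length_le (hzf j), hRzf j hj hjS]
      decide
    · rw [if_neg hjS]
      decide

/-- The `body` code of a list of short strings is short. [folklore] -/
theorem length_body_le {zs : List (List Bool)} {b : ℕ} (h : ∀ z ∈ zs, z.length ≤ b) :
    (OracleCompose.body zs).length ≤ zs.length * (2 * b + 2) := by
  induction zs with
  | nil => simp
  | cons z zs ih =>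
    have hz := h z (by simp)
    have ih' := ih fun z' hz' => h z' (by simp [hz'])
    simp only [OracleCompose.body_cons, length_boolPair, List.length_cons]
    nlinarith

end Relation

/-! ### The verifier: composition and running time -/

section Verifier

variable (R S : Language Bool) (f : List Bool → List Bool) (p : Polynomial ℕ)
  (R' : List Bool → List Bool → Bool) (r' c' : ℕ)

/-- **The clock words of the rounds of a word are short**: `|g1T … x Yc 1ʲ| ≤ P₁(|x|) + 1` for
`j < |⟨x, Yc⟩|`, with `P₁ = p_f ∘ (3 (2X + 2 + p) + 2)` for an output-length bound `p_f` of `f`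
(the length guard bounds `|Yc|` by `p(|x|)` whenever the clock word is a query). [folklore] -/
theorem length_g1T_round_le {pf : Polynomial ℕ} (hpf : ∀ v, (f v).length ≤ pf.eval v.length)
    (x Yc : List Bool) {j : ℕ} (hj : j < (boolPair x Yc).length) :
    (g1T R S f p x Yc (ones j)).length ≤
      (pf.comp (Polynomial.C 3 * (Polynomial.C 2 * X + Polynomial.C 2 + p) + Polynomial.C 2)).eval x.length + 1 := by
  classical
  refine (length_g1T_le R S f p x Yc (ones j)).trans ?_
  split_ifs with hY
  · refine Nat.add_le_add_right ((hpf _).trans ?_) 1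
    simp only [eval_comp, eval_add, eval_mul, eval_C, eval_X]
    refine TM2Iter.eval_mono pf ?_
    simp only [length_boolPair, ones, List.length_replicate] at hj ⊢
    omega
  · exact Nat.succ_le_succ (Nat.zero_le _)

variable {R S f p R' r' c'}

/-- **The verifier and its running time**: the truncating wrapper of the clock followed by the
checking machine computes the relation `relOf … U x y` within
`Q(2n+2+U(n)) + (2n+2+U(n)) · K · 2^{⌊B^{1/r'}⌋} + T_clock(n) + 5n + 2U(n) + |y|/2 + 11` steps, for any
bound `B` on the clock words of the rounds. [cite: KabanetsImpagliazzo2003, Lemma 3 (p. 357)] -/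
theorem verifier_outputsWithin {Nclk D : TM2ComputableAux Bool Bool} {U Tclk : ℕ → ℕ}
    (hNclk : ∀ x, Nclk.OutputsWithin x (boolPair x (List.replicate (U x.length) true)) (Tclk x.length))
    {QD : Polynomial ℕ} {KD : ℕ}
    (hD : ∀ (x c : List Bool) (B : ℕ),
      (∀ j < (boolPair x (fstF c)).length, (g1T R S f p x (fstF c) (ones j)).length ≤ B) →
      D.OutputsWithin (boolPair x c)
        [!((List.range (boolPair x (fstF c)).length).any fun j =>
            qbit R S f p R' r' c' x (fstF c) (ones j) (elemOf (sndF c) j))]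
        (QD.eval (boolPair x c).length + (boolPair x c).length * (KD * 2 ^ Nat.nthRoot r' B)))
    (x y : List Bool) (B : ℕ)
    (hB : ∀ j < (boolPair x (fstF (y.take (U x.length)))).length,
      (g1T R S f p x (fstF (y.take (U x.length))) (ones j)).length ≤ B) :
    ((truncMapAux Nclk).comp D).OutputsWithin (boolPair x y) [relOf R S f p R' r' c' U x y]
      (QD.eval (2 * x.length + 2 + U x.length) + (2 * x.length + 2 + U x.length) * (KD * 2 ^ Nat.nthRoot r' B) +
        (Tclk x.length + 5 * x.length + 2 * U x.length + y.length / 2 + 11)) := by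
  have h₁ := outputsWithin_truncMapAux_boolPair Nclk (y := y) (hNclk x)
  simp only [List.length_replicate] at h₁
  have h₂ := hD x (y.take (U x.length)) B hB
  have h := TM2ComputableAux.comp_outputsWithin _ _ h₁ h₂
  refine h.mono ?_
  have hclen : (y.take (U x.length)).length ≤ U x.length := List.length_take_le _ _
  have hW : (boolPair x (y.take (U x.length))).length ≤ 2 * x.length + 2 + U x.length := by
    rw [length_boolPair]; omega
  have hQD := TM2Iter.eval_mono QD hW
  have hmul : (boolPair x (y.take (U x.length))).length * (KD * 2 ^ Nat.nthRoot r' B) ≤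
      (2 * x.length + 2 + U x.length) * (KD * 2 ^ Nat.nthRoot r' B) := Nat.mul_le_mul_right _ hW
  omega

end Verifier

/-! ### The closure theorem -/

/-- **Guess-and-verify closure of `NSUBEXP`** (the verifier form of Kabanets–Impagliazzo 2003,
Lemma 3, p. 357): for `A ∈ NSUBEXP`, `R, S ∈ P`, `f ∈ FP` and a polynomial `p`, the guarded ball
`{x | ∃ Y, |Y| ≤ p(|x|) ∧ ⟨x, Y⟩ ∈ R ∧ ∀ j < |⟨x, Y⟩|, ⟨⟨x, Y⟩, 1ʲ⟩ ∈ S → f ⟨⟨x, Y⟩, 1ʲ⟩ ∈ A}` is in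
`NSUBEXP`: for the member `r` of the intersection, guess `Y` and the certificates of all queries
at once, cut the certificate at the clock `clockLen p r₁ C₀ |x|` and check every round with the
member `r' = 2e(2d(r+1)+1)` of the presentation of `A`; all costs are `2^{O(⌊n^{1/(r+1)}⌋)}`, which
is eventually `≤ 2^{⌊n^{1/r}⌋}`. [cite: KabanetsImpagliazzo2003, Lemma 3 (p. 357) and proof of Thm. 18 (p. 359)] -/
theorem mem_NSUBEXP_of_guardedBall {A R S : Language Bool} {f : List Bool → List Bool}
    (p : Polynomial ℕ) (hA : A ∈ NSUBEXP) (hR : R ∈ Classes.P) (hS : S ∈ Classes.P) (hf : f ∈ FP) :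
    guardedBall A R S f p ∈ NSUBEXP := by
  classical
  refine mem_NSUBEXP_iff.2 fun r hr => ?_
  have hr0 : r ≠ 0 := hr.ne'
  -- polynomial bounds: `2n + 2 + p(n)` bounds a guarded word, `P₁ n` the queries of its rounds
  obtain ⟨pf, hpf⟩ := exists_poly_length_le_of_mem_FP hf
  obtain ⟨A₀, d, hd, hA₀⟩ := exists_eval_le_mul_pow_add_pos (Polynomial.C 2 * X + Polynomial.C 2 + p)
  obtain ⟨A₁, e, he, hA₁⟩ := exists_eval_le_mul_pow_add_pos
    (pf.comp (Polynomial.C 3 * (Polynomial.C 2 * X + Polynomial.C 2 + p) + Polynomial.C 2) + 1)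
  -- the root indices `r < rm ≤ r₁ < rin ≤ r'`
  have hrm : r + 1 ≠ 0 := Nat.succ_ne_zero r
  have hr₁ : 2 * d * (r + 1) ≠ 0 := Nat.mul_ne_zero (Nat.mul_ne_zero two_ne_zero hd) hrm
  have hrin : 2 * d * (r + 1) + 1 ≠ 0 := Nat.succ_ne_zero _
  have hr' : 2 * e * (2 * d * (r + 1) + 1) ≠ 0 := Nat.mul_ne_zero (Nat.mul_ne_zero two_ne_zero he) hrin
  have hmid_le_in : r + 1 ≤ 2 * d * (r + 1) + 1 := by
    have : 1 ≤ 2 * d := by omega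
    nlinarith
  obtain ⟨K₀, hK₀⟩ := PolyExistsNTIME.exists_nthRoot_poly_le A₀ hd hrm
  obtain ⟨K₁, hK₁⟩ := PolyExistsNTIME.exists_nthRoot_poly_le A₁ he hrin
  have hroot₁ : ∀ n, Nat.nthRoot (2 * d * (r + 1)) (PolyExistsNTIME.lenM p n) ≤ Nat.nthRoot (r + 1) n + K₀ :=
    fun n => by
    refine (PolyExistsNTIME.nthRoot_mono_right hr₁ ?_).trans (hK₀ n)
    have := hA₀ n
    simp only [eval_add, eval_mul, eval_C, eval_X, PolyExistsNTIME.lenM] at this ⊢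
    exact this
  have hrootin : ∀ n,
      Nat.nthRoot (2 * e * (2 * d * (r + 1) + 1))
        ((pf.comp (Polynomial.C 3 * (Polynomial.C 2 * X + Polynomial.C 2 + p) + Polynomial.C 2)).eval n + 1) ≤
      Nat.nthRoot (2 * d * (r + 1) + 1) n + K₁ := fun n => by
    refine (PolyExistsNTIME.nthRoot_mono_right hr' ?_).trans (hK₁ n)
    have := hA₁ n
    rw [eval_add, eval_one] at this
    exact this
  have hroot' : ∀ n,
      Nat.nthRoot (2 * e * (2 * d * (r + 1) + 1))
        ((pf.comp (Polynomial.C 3 * (Polynomial.C 2 * X + Polynomial.C 2 + p) + Polynomial.C 2)).eval n + 1) ≤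
      Nat.nthRoot (r + 1) n + K₁ := fun n =>
    (hrootin n).trans (Nat.add_le_add_right (nthRoot_anti_left hrm hmid_le_in n) _)
  -- the presentation of `A` at index `r'`
  obtain ⟨c', R', M', hM', hAiff⟩ := mem_NSUBEXP_iff.1 hA (2 * e * (2 * d * (r + 1) + 1)) (Nat.pos_of_ne_zero hr')
  have hAiff' : ∀ t, t ∈ A ↔ ∃ z, z.length ≤ admLen (2 * e * (2 * d * (r + 1) + 1)) c' t.length ∧ R' t z = true :=
    hAiff
  -- the checking machine
  obtain ⟨QD, KD, D, hD⟩ := exists_checkMachine p R' c' hR hS hf hr' M' (fun t z hz => hM' t z hz)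
  -- the clock constant: the honest certificates fit below the clock
  obtain ⟨C₀, hC₀⟩ : ∃ C₀ : ℕ, ∀ n : ℕ,
      (2 * n + 2 + p.eval n) * (2 * (c' * 2 ^ (Nat.nthRoot (2 * d * (r + 1) + 1) n + K₁) + c') + 2) ≤
        C₀ * 2 ^ Nat.nthRoot (2 * d * (r + 1)) n + C₀ := by
    obtain ⟨C, hC⟩ := exists_poly_mul_two_pow_nthRoot_le
      ((Polynomial.C 2 * X + Polynomial.C 2 + p) * Polynomial.C (2 * c' * 2 ^ K₁)) hr₁ (Nat.lt_succ_self _)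
    obtain ⟨C', hC'⟩ := PolyExistsNTIME.exists_poly_le_two_pow_nthRoot
      ((Polynomial.C 2 * X + Polynomial.C 2 + p) * Polynomial.C (2 * c' + 2)) hr₁
    refine ⟨C + C', fun n => ?_⟩
    have h1 := hC n
    have h2 := hC' n
    simp only [eval_mul, eval_C, eval_add, eval_X] at h1 h2
    have e1 : (2 * n + 2 + p.eval n) * (2 * (c' * 2 ^ (Nat.nthRoot (2 * d * (r + 1) + 1) n + K₁) + c') + 2) =
        (2 * n + 2 + p.eval n) * (2 * c' * 2 ^ K₁) * 2 ^ Nat.nthRoot (2 * d * (r + 1) + 1) n +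
          (2 * n + 2 + p.eval n) * (2 * c' + 2) := by
      rw [pow_add]; ring
    rw [e1]
    nlinarith
  -- the outer clock
  obtain ⟨Nclk, hNclk⟩ := exists_outerClock_machine p hr₁ C₀
  obtain ⟨Pc, Kc, hPc⟩ := exists_cClock_le p (2 * d * (r + 1)) C₀
  -- the cost bound `F` and its growth `2^{O(⌊n^{1/(r+1)}⌋)}`
  obtain ⟨F, hFdef⟩ : ∃ F : ℕ → ℕ, ∀ n, F n =
      QD.eval (2 * n + 2 + PolyExistsNTIME.clockLen p (2 * d * (r + 1)) C₀ n) +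
      (2 * n + 2 + PolyExistsNTIME.clockLen p (2 * d * (r + 1)) C₀ n) *
        (KD * 2 ^ Nat.nthRoot (2 * e * (2 * d * (r + 1) + 1))
          ((pf.comp (Polynomial.C 3 * (Polynomial.C 2 * X + Polynomial.C 2 + p) + Polynomial.C 2)).eval n + 1)) +
      (Pc.eval n + Kc * 2 ^ PolyExistsNTIME.rootM p (2 * d * (r + 1)) n) + 5 * n +
      2 * PolyExistsNTIME.clockLen p (2 * d * (r + 1)) C₀ n + 11 := ⟨_, fun n => rfl⟩
  have hS1 : ∀ n : ℕ, 1 ≤ Nat.nthRoot (r + 1) n + 1 := fun n => Nat.succ_pos _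
  have bnd_n : NKannan.Bnd (fun n => Nat.nthRoot (r + 1) n + 1) fun n => n := bnd_self hrm
  have bnd_poly : ∀ q : Polynomial ℕ, NKannan.Bnd (fun n => Nat.nthRoot (r + 1) n + 1) fun n => q.eval n :=
    fun q => NKannan.Bnd.poly hS1 q bnd_n
  have bnd_exp₁ : NKannan.Bnd (fun n => Nat.nthRoot (r + 1) n + 1) fun n =>
      2 ^ Nat.nthRoot (2 * d * (r + 1)) (PolyExistsNTIME.lenM p n) :=
    NKannan.Bnd.two_pow hS1 (K₀ + 1) fun n => by have := hroot₁ n; nlinarith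
  have bnd_exp' : NKannan.Bnd (fun n => Nat.nthRoot (r + 1) n + 1) fun n =>
      2 ^ Nat.nthRoot (2 * e * (2 * d * (r + 1) + 1))
        ((pf.comp (Polynomial.C 3 * (Polynomial.C 2 * X + Polynomial.C 2 + p) + Polynomial.C 2)).eval n + 1) :=
    NKannan.Bnd.two_pow hS1 (K₁ + 1) fun n => by have := hroot' n; nlinarith
  have bnd_U : NKannan.Bnd (fun n => Nat.nthRoot (r + 1) n + 1) fun n =>
      PolyExistsNTIME.clockLen p (2 * d * (r + 1)) C₀ n := by
    have h := NKannan.Bnd.add hS1 (bnd_poly (Polynomial.C 2 * p + Polynomial.C 2))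
      (NKannan.Bnd.add hS1 (NKannan.Bnd.mul (NKannan.Bnd.const hS1 C₀) bnd_exp₁) (NKannan.Bnd.const hS1 C₀))
    refine h.mono fun n => ?_
    simp [PolyExistsNTIME.clockLen, PolyExistsNTIME.lenM]
  have bnd_W : NKannan.Bnd (fun n => Nat.nthRoot (r + 1) n + 1) fun n =>
      2 * n + 2 + PolyExistsNTIME.clockLen p (2 * d * (r + 1)) C₀ n :=
    NKannan.Bnd.add hS1 ((bnd_poly (Polynomial.C 2 * X + Polynomial.C 2)).mono fun n => by simp) bnd_U
  have bnd_F : NKannan.Bnd (fun n => Nat.nthRoot (r + 1) n + 1) F := by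
    have hQ := NKannan.Bnd.poly hS1 QD bnd_W
    have hKD := NKannan.Bnd.mul bnd_W (NKannan.Bnd.mul (NKannan.Bnd.const hS1 KD) bnd_exp')
    have hPc := bnd_poly Pc
    have hKc := NKannan.Bnd.mul (NKannan.Bnd.const hS1 Kc) bnd_exp₁
    have h5 : NKannan.Bnd (fun n => Nat.nthRoot (r + 1) n + 1) fun n => 5 * n :=
      (bnd_poly (Polynomial.C 5 * X)).mono fun n => by simp
    have h2U := NKannan.Bnd.mul (NKannan.Bnd.const hS1 2) bnd_U
    have h11 := NKannan.Bnd.const hS1 11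
    have h := NKannan.Bnd.add hS1 (NKannan.Bnd.add hS1 (NKannan.Bnd.add hS1 (NKannan.Bnd.add hS1
      (NKannan.Bnd.add hS1 hQ hKD) (NKannan.Bnd.add hS1 hPc hKc)) h5) h2U) h11
    refine h.mono fun n => ?_
    rw [hFdef]
    rfl
  obtain ⟨a, ha⟩ := bnd_F
  obtain ⟨N₀, hN₀⟩ := eventually_mul_nthRoot_le hr0 (Nat.lt_succ_self r) a
  obtain ⟨Kfin, hKfin⟩ : ∃ Kfin : ℕ, Kfin = 2 ^ (a * (Nat.nthRoot (r + 1) N₀ + 1)) := ⟨_, rfl⟩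
  have hFle : ∀ n, F n ≤ 2 ^ Nat.nthRoot r n + Kfin := fun n => by
    rcases le_or_gt N₀ n with hn | hn
    · have h1 : a * (Nat.nthRoot (r + 1) n + 1) ≤ Nat.nthRoot r n := by have := hN₀ n hn; nlinarith
      exact ((ha n).trans (Nat.pow_le_pow_right Nat.two_pos h1)).trans (Nat.le_add_right _ _)
    · have h1 : a * (Nat.nthRoot (r + 1) n + 1) ≤ a * (Nat.nthRoot (r + 1) N₀ + 1) :=
        Nat.mul_le_mul_left a (Nat.succ_le_succ (PolyExistsNTIME.nthRoot_mono_right hrm hn.le))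
      rw [hKfin]
      exact ((ha n).trans (Nat.pow_le_pow_right Nat.two_pos h1)).trans (Nat.le_add_left _ _)
  -- the verifier
  refine ⟨2 * Kfin + 2, relOf R S f p R' (2 * e * (2 * d * (r + 1) + 1)) c'
      (fun n => PolyExistsNTIME.clockLen p (2 * d * (r + 1)) C₀ n),
    (truncMapAux Nclk).comp D, fun x y hy => ?_, fun x => ?_⟩
  · -- running time
    have h := verifier_outputsWithin (R' := R') (c' := c')
      (U := fun n => PolyExistsNTIME.clockLen p (2 * d * (r + 1)) C₀ n)
      (Tclk := fun n => PolyExistsNTIME.cClock p (2 * d * (r + 1)) C₀ n + 1) hNclk hD x y _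
      (fun j hj => length_g1T_round_le R S f p hpf x _ hj)
    refine h.mono ?_
    have hFn := hFle x.length
    rw [hFdef] at hFn
    have hclock := hPc x.length
    have hy' : y.length ≤ (2 * Kfin + 2) * 2 ^ Nat.nthRoot r x.length + (2 * Kfin + 2) := hy
    have hy2 := Nat.mul_div_le y.length 2
    nlinarith [hFn, hclock, hy', hy2, Nat.zero_le (Kfin * 2 ^ Nat.nthRoot r x.length)]
  · -- correctness
    constructor
    · -- completeness
      intro hx
      obtain ⟨Y, zs, hY, hzs, hzlen, hrel⟩ := relOf_complete (R' := R') hAiff' hx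
      -- the honest certificate fits below the clock
      have hb : ∀ z ∈ zs, z.length ≤ c' * 2 ^ (Nat.nthRoot (2 * d * (r + 1) + 1) x.length + K₁) + c' := by
        intro z hz
        obtain ⟨j, hj, hjz⟩ := hzlen z hz
        refine hjz.trans ?_
        have hv : (f (boolPair (boolPair x Y) (ones j))).length ≤
            (pf.comp (Polynomial.C 3 * (Polynomial.C 2 * X + Polynomial.C 2 + p) + Polynomial.C 2)).eval x.length := by
          refine (hpf _).trans ?_
          simp only [eval_comp, eval_add, eval_mul, eval_C, eval_X]
          refine TM2Iter.eval_mono pf ?_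
          simp only [length_boolPair, ones, List.length_replicate] at hj ⊢
          omega
        have hρ := (PolyExistsNTIME.nthRoot_mono_right hr' (hv.trans (Nat.le_succ _))).trans (hrootin x.length)
        have := Nat.pow_le_pow_right Nat.two_pos hρ
        simp only [admLen]
        nlinarith
      have hbody := length_body_le hb
      have hlenU : (boolPair Y (OracleCompose.body zs)).length ≤
          PolyExistsNTIME.clockLen p (2 * d * (r + 1)) C₀ x.length := by
        have h1 := hC₀ x.length
        have h2 : 2 ^ Nat.nthRoot (2 * d * (r + 1)) x.length ≤
            2 ^ Nat.nthRoot (2 * d * (r + 1)) (2 * x.length + 2 + p.eval x.length) :=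
          Nat.pow_le_pow_right Nat.two_pos (PolyExistsNTIME.nthRoot_mono_right hr₁ (by omega))
        have hk : zs.length ≤ 2 * x.length + 2 + p.eval x.length := by rw [hzs, length_boolPair]; omega
        have h3 := Nat.mul_le_mul_right
          (2 * (c' * 2 ^ (Nat.nthRoot (2 * d * (r + 1) + 1) x.length + K₁) + c') + 2) hk
        simp only [PolyExistsNTIME.clockLen, length_boolPair]
        nlinarith [Nat.mul_le_mul_left C₀ h2]
      refine ⟨boolPair Y (OracleCompose.body zs), ?_, hrel _ hlenU⟩
      have hFn := hFle x.length
      rw [hFdef] at hFn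
      have : PolyExistsNTIME.clockLen p (2 * d * (r + 1)) C₀ x.length ≤ 2 ^ Nat.nthRoot r x.length + Kfin := by omega
      have h1 : 1 ≤ 2 ^ Nat.nthRoot r x.length := Nat.one_le_two_pow
      show (boolPair Y (OracleCompose.body zs)).length ≤ (2 * Kfin + 2) * 2 ^ Nat.nthRoot r x.length + (2 * Kfin + 2)
      nlinarith
    · -- soundness
      rintro ⟨y, -, hy⟩
      exact relOf_sound hAiff' hy

end Literature.Computability.Complexity
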